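import Summits.CriticalPhenomena.PercolationContinuityZ3.Theorems.FK.Transplant.CriticalPointStrictMono
import Summits.CriticalPhenomena.PercolationContinuityZ3.Theorems.FK.Transplant.FHSlabThresholdQOne
import HarnessLib

/-!
# FRONTIER TRANSPLANT, binder 1 (FH) calibration — the K1 interval for `q > 1` lies STRICTLY above the Bernoulli
# threshold: `p_c(ℤ^d) = p̂_c(1) < p_c(q) ≤ p̂_c(q)`, with the explicit gap of `CriticalPointStrictMono`

Registered R71 (cell INBOX l.5302, 2026-08-23); registry row T1m; label T1m-F (coordinator fk-4 g139; adopted by the lead, L45 l.5303 = typer read NO OBJECTION at the statement layer); placement R71 (δ): all seven files of this package live under `Theorems/FK/Transplant/` (own-chain imports re-pointed; statements untouched).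
Support file (`--supports stmt-CriticalPhenomena-4575`, helper) of the FRONTIER TRANSPLANT sub-cell
(`fk-continuity/transplant/`, seat `prim-bschramm-fkt-p2`); builds on p205010 (kernel theorem, internal audit signed;
external expert review pending). No definitions, no named facts, no sorries; standard axioms. Sequel of
`Transplant/FHSlabThresholdQOne.lean` (T1q-C, this lineage) and of `Theorems/FK/CriticalPointStrictMono.lean`.

HONEST FRAMING (page 1, cell rule). The transplant's theorem of record `ufsc0_of_freeBoundaryHypothesis_r3`
(p248245, « 2 / 0 ☑ ») is CONDITIONAL on FH AND on TP_FK, both OPEN at the same `p` for `q > 1` near `p_c(q)`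
(⇔ GRC Conj. (5.103) via K1; barrier note `Literature.Barriers.CriticalPhenomena.SamePFreeBoundaryCriteria`, FBN-01);
the transplant is a typed reduction, not a proof of FK continuity. THIS FILE DOES NOT CHANGE THAT; it is
UNCONDITIONAL and says where the K1 interval `[p_c(q), p̂_c(q)]` sits for `q > 1`: STRICTLY to the right of
`p_c(ℤ^d) = p̂_c(1)` (T1q-C + GRC Thm. (5.10)), quantitatively by at least `(q-1)·p_c(q)(1-p_c(q))^{2d}/(8dq)`;
in particular there is NO free slab percolation `Π(p, L)` at cluster weight `q > 1` for any `p` up to that distance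
above the percolation threshold. Nothing is claimed about `p̂_c(q) = p_c(q)` for `q > 1`; not a binder discharge,
not a re-cut, not `_r4`; `_r3` « 2 / 0 ☑ », n_open = 2, BINDER-OWNERS, FO-19 NO-GO unchanged.

## Contents (namespace `Summit.CriticalPhenomena.PercolationContinuityZ3.Theorems.FK`)

`criticalProb_lt_fkSlabCriticalProb` (`p_c(ℤ^d) < p̂_c(q)`, `q > 1`, `d ≥ 2`), `fkSlabCriticalProb_one_lt`
(`p̂_c(1) < p̂_c(q)`), `criticalProb_add_le_rcCriticalProb` / `criticalProb_add_le_fkSlabCriticalProb`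
(`p_c(ℤ^d) + (q-1)p_c(q)(1-p_c(q))^{2d}/(8dq) ≤ p_c(q) ≤ p̂_c(q)`), `not_fkSlabPercolation_of_lt_rcCriticalProb`,
`not_fkSlabPercolation_near_criticalProb` (no `Π(p, L)` for `p < p_c(ℤ^d) + (q-1)p_c(q)(1-p_c(q))^{2d}/(8dq)`).

## References

* G. Grimmett, *The Random-Cluster Model*, Springer 2006: Thm. (5.10) p. 99; §5.7 (5.102), Conj. (5.103). [Grimmett2006]
* F. Severo, ECP 29 (2024), §1 (definition of `p̂_c`). [Severo2024]
-/

noncomputable section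

open scoped Classical

namespace Summit.CriticalPhenomena.PercolationContinuityZ3.Theorems.FK

open Literature.Probability.Percolation Literature.Probability.LatticeModels
open Literature.Barriers.CriticalPhenomena

variable {d : ℕ}

/-- **`p_c(ℤ^d) < p̂_c(q)` for `q > 1`, `d ≥ 2`**: the free-slab threshold of FBN-01 lies strictly above the
percolation threshold (`p_c(ℤ^d) < p_c(q) ≤ p̂_c(q)`). [cite: Grimmett2006, Thm. (5.10) and §5.7 ("Clearly p_c(q) ≤ p̂_c(q)")] -/
theorem criticalProb_lt_fkSlabCriticalProb (hd : 2 ≤ d) {q : ℝ} (hq : 1 < q) :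
    criticalProb (zdGraph d) (0 : Site d) < fkSlabCriticalProb d q :=
  (criticalProb_lt_rcCriticalProb hd hq).trans_le (rcCriticalProb_le_fkSlabCriticalProb (by omega) hq.le)

/-- **`p̂_c(1) < p̂_c(q)` for `q > 1`, `d ≥ 2`** (with T1q-C `p̂_c(1) = p_c(ℤ^d)`): the slab threshold is strictly
larger at every `q > 1` than at `q = 1`. [cite: Grimmett2006, Thm. (5.10) and §5.7 Conj. (5.103) (the case q = 1)] -/
theorem fkSlabCriticalProb_one_lt [NeZero d] (hd : 2 ≤ d) {q : ℝ} (hq : 1 < q) :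
    fkSlabCriticalProb d 1 < fkSlabCriticalProb d q := by
  rw [fkSlabCriticalProb_one_eq_criticalProb hd]
  exact criticalProb_lt_fkSlabCriticalProb hd hq

/-- The explicit gap above the percolation threshold: for `q ≥ 1`, `d ≥ 2`,
`p_c(ℤ^d) + (q-1)·p_c(q)(1-p_c(q))^{2d}/(8dq) ≤ p_c(q)` (`rcCriticalProb_sub_ge` at `q₂ = 1` with `p_c(1) = p_c(ℤ^d)`).
[cite: Grimmett2006, Thm. (5.10) p. 99] -/
theorem criticalProb_add_le_rcCriticalProb (hd : 2 ≤ d) {q : ℝ} (hq : 1 ≤ q) :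
    criticalProb (zdGraph d) (0 : Site d) +
        (q - 1) * (rcCriticalProb d q * (1 - rcCriticalProb d q) ^ (2 * d)) / (8 * d * q) ≤
      rcCriticalProb d q := by
  have h := rcCriticalProb_sub_ge hd le_rfl hq
  rw [rcCriticalProb_one_eq_criticalProb] at h
  linarith

/-- The same gap below the slab threshold: `p_c(ℤ^d) + (q-1)·p_c(q)(1-p_c(q))^{2d}/(8dq) ≤ p̂_c(q)` (`q ≥ 1`, `d ≥ 2`).
[cite: Grimmett2006, Thm. (5.10) and §5.7 ("Clearly p_c(q) ≤ p̂_c(q)")] -/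
theorem criticalProb_add_le_fkSlabCriticalProb (hd : 2 ≤ d) {q : ℝ} (hq : 1 ≤ q) :
    criticalProb (zdGraph d) (0 : Site d) +
        (q - 1) * (rcCriticalProb d q * (1 - rcCriticalProb d q) ^ (2 * d)) / (8 * d * q) ≤
      fkSlabCriticalProb d q :=
  (criticalProb_add_le_rcCriticalProb hd hq).trans (rcCriticalProb_le_fkSlabCriticalProb (by omega) hq)

/-- No free slab percolation strictly below `p_c(q)`: for `q ≥ 1`, `d ≥ 1`, `p ∈ [0, 1]` with `p < p_c(q)`,
`¬ Π(p, L)` for every `L` (slab percolation at `p` would give `p_c(q) ≤ p`).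
[cite: Grimmett2006, §5.7 ("Clearly p_c(q) ≤ p̂_c(q)")] -/
theorem not_fkSlabPercolation_of_lt_rcCriticalProb (hd : 1 ≤ d) {p q : ℝ} (hq : 1 ≤ q)
    (hp : p ∈ Set.Icc (0 : ℝ) 1) (hlt : p < rcCriticalProb d q) (L : ℕ) : ¬ FKSlabPercolation d p q L :=
  fun h => absurd (rcCriticalProb_le_of_fkSlabPercolation hd hq hp h) (not_le.2 hlt)

/-- **No free slab percolation at cluster weight `q ≥ 1` anywhere below `p_c(ℤ^d) + (q-1)·p_c(q)(1-p_c(q))^{2d}/(8dq)`**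
(`d ≥ 2`, `p ∈ [0, 1]`): the same-`p` free-slab input of the programme is unavailable, for `q > 1`, in an explicit
neighbourhood ABOVE the percolation threshold. [cite: Grimmett2006, Thm. (5.10) and §5.7 (5.102)–(5.103)] -/
theorem not_fkSlabPercolation_near_criticalProb (hd : 2 ≤ d) {p q : ℝ} (hq : 1 ≤ q) (hp : p ∈ Set.Icc (0 : ℝ) 1)
    (hlt : p < criticalProb (zdGraph d) (0 : Site d) +
        (q - 1) * (rcCriticalProb d q * (1 - rcCriticalProb d q) ^ (2 * d)) / (8 * d * q)) (L : ℕ) :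
    ¬ FKSlabPercolation d p q L :=
  not_fkSlabPercolation_of_lt_rcCriticalProb (by omega) hq hp
    (hlt.trans_le (criticalProb_add_le_rcCriticalProb hd hq)) L

end Summit.CriticalPhenomena.PercolationContinuityZ3.Theorems.FK

end
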